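import Summits.QuantumFields.YangMills.Theorems.BalabanUVNodesN15CovariantTwoGridSpeciesFitA
import HarnessLib

/-!
# N15 = NE2, road (c) — PROGRAMME (PC) «[B9] Sect. C FOR THE LANDAU LETTER WITH PER-CUBE GAUGES (3.35) AS PRINTED», (PC-E) (C6-d2): THE ZEROTH-ORDER SPECIES FIT ACROSS KING's
# PAIRING REDUCED TO THE DIVERGENCE-TERM FIT — `c = η⁻¹Σ_μ(a⁺_μ − a⁻_μ) = Σ_μ[η⁻²(S_μ(x) − S_μ(x−e_μ)) − ã_μã_μᵀ]` (orthogonality cancellation, `ã_μ = η⁻¹(S_μ(x−e_μ) − 1)`), so n15-c∕340's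
# `hfitC` is the displayed fit `o_B` of the divergence-type term `b_μ = η⁻²(S_μ(x) − S_μ(x−e_μ))` plus quadratic terms controlled by n15-c∕343's first-order fit (dag-n15-c g32, n15-c∕344)

Cell `pub-ymgap`, seat `pub-ymgap-dag-n15-c` (generation g32; R134 (a) seat, strategy s1 «first missing estimate»; HUMAN RULING D-0062; chair R424 venue).
`bears_on: R4∕N15 · K3⁸ SpineGivenEndpointR13SepCoPHV (stmt-QuantumFields-27366)`; filed `--kind proof --supports stmt-QuantumFields-27366 --as helper` — COUNT-NEUTRAL.
THEOREMS only ([folklore] real-matrix algebra + entry bookkeeping), 0 `def`, 0 `sorry`.  Imports BY NAME n15-c∕343 `…CovariantTwoGridSpeciesFitA` (`abs_tCoefA_fit_entry_le`, `sub_transpose_fit_entry`;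
through it n15-c∕341, dag-n15-w2's entry letters, n15-b `tCoefA`∕`tCoefC`, dag-n15-w3 `gaugePair`, dag-n15-a `scChi'_eq_scChi_kingPr`).  Nothing in the tree is modified, no landed name re-declared.

WHY ∕ WHAT.  n15-b's exact zeroth-order coefficient is `tCoefC η R x = η⁻¹Σ_μ(a⁺_μ(x) − a⁻_μ(x))`; for an ORTHOGONAL transporter field (`S_μS_μᵀ = 1`, true for `coordMat e Ad_V`, `V` unitary)
★ `inv_smul_tCoefA_sub_eq`: `η⁻¹(a⁺_μ − a⁻_μ) = η⁻²(S_μ(x) − S_μ(x−e_μ)) − ã_μã_μᵀ` — [B9] (3.52)'s structure «`i[(D^{η*}_UA′)(x), ·] + F′`»: a DIVERGENCE-type first difference of the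
transporters plus a quadratic term.  Across King's pairing the quadratic term fits by n15-c∕343 (★ `abs_mul_transpose_fit_entry_le`: `|(ã′ã′ᵀ − ããᵀ)_{ij}| ≤ |ι|δ(P′ + P)`), so ★★★
`sc_hfitC_of_pairing` gives n15-c∕340's `hfitC` LITERALLY from: the covariant pairing, the (3.35) letter on the fine lines, 343's oscillation letter `Ω`, AND the displayed fit `o_B` of the
divergence-type terms `|(η′⁻²(S′_μ(x′) − S′_μ(x′−e′_μ)) − η⁻²(S_μ(πx′) − S_μ(πx′−e_μ)))_{ij}| ≤ o_B` — `o_V^C = |ι||J|(o_B + |ι|δ(P₁ + P_c))`.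

LOCATED (the remaining two-grid input, honest).  `o_B` small in `η` is the statement that the lattice divergence of the transformed connection varies by `o(1)` over a King cell: with
`U′ = e^{iη′A′}` it is the cell oscillation of `∂^{η*}A′`, of size `η·|∇∂^{η*}A′|` — a bound on SECOND covariant differences of `A′` componentwise, i.e. (3.36)-strength regularity
«|∂^{η*}∂^ηA| < O(1)Mα₀(L^jη)^{−3}» ([B9] p.396: «later on we will have to assume (3.36) also») in the component form the model species needs; its producer is NOT in the tree.

HONEST FRAMING ∕ LIMITS.  Elementary; MODEL pairing and carriers; `o_B`, `Ω` and the set geometry displayed; nothing of [B9] asserted ((3.35)–(3.36) p.396, (3.51)–(3.52) p.400 = SHAPES).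
NE2⁺ NOT PRINTED, NOT proved; N15 of record untouched (DISCHARGED AS CONSUMED, p687738); K3⁸ OPEN; counts of record UNMOVED (typed 28∕28 · discharged 8∕27); one finite 𝕋⁴ at fixed ε per
index — NOT infinite volume, NOT OS on ℝ⁴, NOT a mass gap, NOT Clay.  Restate-immune (no Theses import).
-/

set_option autoImplicit false

noncomputable section

open scoped BigOperators Matrix Matrix.Norms.L2Operator
open Finset

namespace Summit.QuantumFields.YangMills.BalabanUVNodes.N15.Gluing

open Literature.MathematicalPhysics.QuantumFieldTheory.Balaban1983to89
open Literature.MathematicalPhysics.QuantumFieldTheory.Balaban1983to89.B5Prop11Plancherel (Tor fine unitVec)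
open Literature.Barriers.QuantumFields (traceForm)
open Summit.QuantumFields.YangMills.BalabanUVNodes.N15.BackgroundLayer (tCoefA tCoefC tCoefA_inl tCoefA_inr)
open Summit.QuantumFields.YangMills.BalabanUVNodes.N15.VectorPiece (kingPr)
open Summit.QuantumFields.YangMills.BalabanUVNodes.N15.MatrixSpecies (coordMat basisConst basisConst_nonneg)
open Summit.QuantumFields.YangMills.BalabanUVNodes.N15.TwoGrid (abs_chiCube_le_one)
open Summit.QuantumFields.YangMills.BalabanUVNodes.N15.CurvedSpecies (gaugePair gaugePair_inl gaugePair_inr uN_abs_coordMat_conj_sub_one_entry_le_op uN_coordMat_conj_orthogonal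
  uN_gaugeTransformed_bond_unitary)
open Summit.QuantumFields.YangMills.BalabanUVNodes.N15.CovAvg (mprod kingSec norm_gauged_lineHol_sub_one_le)

/-! ## §1 The orthogonality cancellation and the quadratic fit (real matrices) -/

section Algebra

variable {ι : Type} [Fintype ι] [DecidableEq ι]

/-- ★ **THE ORTHOGONALITY CANCELLATION, FIRST-DIFFERENCE FORM**: for `S₋S₋ᵀ = 1`, `η⁻¹(η⁻¹(S − 1) − η⁻¹(1 − S₋ᵀ)) = η⁻²(S − S₋) − (η⁻¹(S₋ − 1))(η⁻¹(S₋ − 1))ᵀ` — [B9] (3.52)'s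
«divergence + quadratic» structure of the zeroth-order coefficient. [cite: Balaban1985BackgroundPropagators, (3.51)–(3.52) p.400 (shape)] -/
theorem inv_smul_tCoefA_sub_eq (η : ℝ) {S Sm : Matrix ι ι ℝ} (hSm : Sm * Smᵀ = 1) :
    η⁻¹ • (η⁻¹ • (S - 1) - η⁻¹ • (1 - Smᵀ)) = (η⁻¹ * η⁻¹) • (S - Sm) - (η⁻¹ • (Sm - 1)) * (η⁻¹ • (Sm - 1))ᵀ := by
  have h2 : (Sm - 1) * (Sm - 1)ᵀ = 1 - Sm - Smᵀ + 1 := by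
    rw [Matrix.transpose_sub, Matrix.transpose_one, Matrix.sub_mul, Matrix.mul_sub, Matrix.mul_sub, hSm, Matrix.one_mul, Matrix.mul_one, Matrix.one_mul]; abel
  rw [Matrix.transpose_smul, Matrix.smul_mul, Matrix.mul_smul, smul_smul, h2]
  module

omit [DecidableEq ι] in
/-- ★ **THE QUADRATIC FIT**: `|(A′A′ᵀ − AAᵀ)_{ij}| ≤ |ι|·δ·(P′ + P)` when `|(A′ − A)_{kl}| ≤ δ`, `|A′_{kl}| ≤ P′`, `|A_{kl}| ≤ P`. [folklore] -/
theorem abs_mul_transpose_fit_entry_le {A A' : Matrix ι ι ℝ} {δ P P' : ℝ} (hd : ∀ k l, |(A' - A) k l| ≤ δ) (hA' : ∀ k l, |A' k l| ≤ P') (hA : ∀ k l, |A k l| ≤ P) (i j : ι) :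
    |(A' * A'ᵀ - A * Aᵀ) i j| ≤ Fintype.card ι * (δ * (P' + P)) := by
  have hδ : 0 ≤ δ := (abs_nonneg _).trans (hd i i)
  rw [Matrix.sub_apply, Matrix.mul_apply, Matrix.mul_apply, ← Finset.sum_sub_distrib]
  refine (Finset.abs_sum_le_sum_abs _ _).trans ?_
  calc ∑ l, |A' i l * A'ᵀ l j - A i l * Aᵀ l j| ≤ ∑ _l : ι, δ * (P' + P) := Finset.sum_le_sum fun l _ => by
        rw [Matrix.transpose_apply, Matrix.transpose_apply]
        have e1 : A' i l * A' j l - A i l * A j l = (A' - A) i l * A' j l + A i l * (A' - A) j l := by simp only [Matrix.sub_apply]; ring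
        rw [e1]
        refine (abs_add_le _ _).trans ?_
        rw [abs_mul, abs_mul, mul_add]
        exact add_le_add (mul_le_mul (hd i l) (hA' j l) (abs_nonneg _) hδ) (by rw [mul_comm]; exact mul_le_mul (hd j l) (hA i l) (abs_nonneg _) hδ)
    _ = Fintype.card ι * (δ * (P' + P)) := by rw [Finset.sum_const, Finset.card_univ, nsmul_eq_mul]

/-- ★★ **THE ZEROTH-ORDER FIT PER DIRECTION**: from the divergence-term fit `o_B`, the first-order fit `δ` of `ã = η⁻¹(S₋ − 1)` across the pairing, and the bounds `P′`, `P` of `ã′`, `ã`: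
`|(η′⁻¹(a′⁺ − a′⁻) − η⁻¹(a⁺ − a⁻))_{ij}| ≤ o_B + |ι|δ(P′ + P)` for orthogonal `S′₋`, `S₋`. [cite: Balaban1985BackgroundPropagators, (3.51)–(3.52) p.400 (shape); King1986, p.664 (pairing)] -/
theorem abs_tCoefC_dir_fit_entry_le {η η' : ℝ} {S Sm S' Sm' : Matrix ι ι ℝ} (hSm : Sm * Smᵀ = 1) (hSm' : Sm' * Sm'ᵀ = 1) {oB δ P P' : ℝ}
    (hB : ∀ i j, |(((η'⁻¹ * η'⁻¹) • (S' - Sm')) - ((η⁻¹ * η⁻¹) • (S - Sm))) i j| ≤ oB)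
    (hd : ∀ k l, |(η'⁻¹ • (Sm' - 1) - η⁻¹ • (Sm - 1)) k l| ≤ δ) (hA' : ∀ k l, |(η'⁻¹ • (Sm' - 1)) k l| ≤ P') (hA : ∀ k l, |(η⁻¹ • (Sm - 1)) k l| ≤ P) (i j : ι) :
    |(η'⁻¹ • (η'⁻¹ • (S' - 1) - η'⁻¹ • (1 - Sm'ᵀ)) - η⁻¹ • (η⁻¹ • (S - 1) - η⁻¹ • (1 - Smᵀ))) i j| ≤ oB + Fintype.card ι * (δ * (P' + P)) := by
  rw [inv_smul_tCoefA_sub_eq η' hSm', inv_smul_tCoefA_sub_eq η hSm, show ∀ a b c e : Matrix ι ι ℝ, (a - b) - (c - e) = (a - c) - (b - e) from fun a b c e => by abel,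
    Matrix.sub_apply]
  exact (abs_sub _ _).trans (add_le_add (hB i j) (abs_mul_transpose_fit_entry_le hd hA' hA i j))

end Algebra

/-! ## §2 On the (PC) site carriers: n15-c∕340's `hfitC` from the divergence-term fit and n15-c∕343's first-order fit -/

section Sites

variable {d : ℕ} {L : ℕ} [NeZero L] {mv kk r : ℕ} {hL : Odd L ∧ 1 < L} {mm : Type} [Fintype mm] [DecidableEq mm] {ι : Type} [Fintype ι] [DecidableEq ι]
  (e : Matrix mm mm ℂ ≃L[ℝ] (ι → ℝ))

set_option maxHeartbeats 400000 in
/-- ★★★ **n15-c∕340's `hfitC` UNDER THE COVARIANT PAIRING, MODULO THE DIVERGENCE-TERM FIT**: per cube `k`, unitary `u′_k`, `U′`, `U` with `U_μ = Π_{t<L^r}U′_μ(σ· + te′_μ)`, the letter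
`‖V′ − 1‖ ≤ η′p` on sets `Qf k ∋` the fine lines over the cut box of `k` and its `−e_μ` neighbours and `∋ x′ − e′_μ`, n15-c∕343's oscillation letter `Ω`, and the DISPLAYED fit `o_B` of the
divergence-type terms `η⁻²(S_μ(x) − S_μ(x − e_μ))` across the pairing at the cut box: `hfitC` holds with `o_V^C = |ι||J|(o_B + |ι|·δ·(κp + L^k·κ((1+η′p)^{L^r} − 1)))`, `δ` = 343's first-order
fit, `κ = κ_e2√|m|√|m|`. [cite: Balaban1985BackgroundPropagators, (3.51)–(3.52) p.400, (3.35)–(3.36) p.396 (shapes); Balaban1985Averaging, (124)–(125) p.36 (pairing: shape); King1986, p.664] -/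
theorem sc_hfitC_of_pairing (he : ∀ A B : Matrix mm mm ℂ, traceForm A B = e A ⬝ᵥ e B) (u' : (Fin (d + 1) → ZMod (2 * L)) → ScX' d L mv kk r hL → Matrix mm mm ℂ) (hu' : ∀ k z, (u' k z)ᴴ * u' k z = 1)
    (U' : Fin (d + 1) → ScX' d L mv kk r hL → Matrix mm mm ℂ) (hU' : ∀ μ z, (U' μ z)ᴴ * U' μ z = 1) (U : Fin (d + 1) → ScX d L mv kk hL → Matrix mm mm ℂ) (hU : ∀ μ y, (U μ y)ᴴ * U μ y = 1)
    (hpair : ∀ μ y, U μ y = mprod (fun t => U' μ (kingSec (cvM d L mv kk hL) L kk r y + t • unitVec (fine (L ^ r * L ^ kk) (cvM d L mv kk hL)) μ)) (L ^ r))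
    (Qf : (Fin (d + 1) → ZMod (2 * L)) → Set (ScX' d L mv kk r hL)) {p Ω oB : ℝ} (hp : 0 ≤ p) (hΩ0 : 0 ≤ Ω) (hoB : 0 ≤ oB)
    (hF1 : ∀ k μ z, z ∈ Qf k → ‖u' k z * U' μ z * (u' k (scShift' d L mv kk r hL μ z))ᴴ - 1‖ ≤ ((((L ^ r * L ^ kk : ℕ) : ℝ))⁻¹) * p)
    (hQl : ∀ k x', scChi d L mv kk hL k (kingPr L kk r (cvM d L mv kk hL) x') ≠ 0 → ∀ μ, (scShift' d L mv kk r hL μ).symm x' ∈ Qf k ∧ ∀ t, t < L ^ r → kingSec (cvM d L mv kk hL) L kk r (kingPr L kk r (cvM d L mv kk hL) x') + t • unitVec (fine (L ^ r * L ^ kk) (cvM d L mv kk hL)) μ ∈ Qf k ∧ kingSec (cvM d L mv kk hL) L kk r ((scShift d L mv kk hL μ).symm (kingPr L kk r (cvM d L mv kk hL) x')) + t • unitVec (fine (L ^ r * L ^ kk) (cvM d L mv kk hL)) μ ∈ Qf k)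
    (hΩ : ∀ k μ x', scChi d L mv kk hL k (kingPr L kk r (cvM d L mv kk hL) x') ≠ 0 → ∀ t < L ^ r, ‖u' k x' * U' μ x' * (u' k (scShift' d L mv kk r hL μ x'))ᴴ - (u' k (kingSec (cvM d L mv kk hL) L kk r (kingPr L kk r (cvM d L mv kk hL) x') + t • unitVec (fine (L ^ r * L ^ kk) (cvM d L mv kk hL)) μ) * U' μ (kingSec (cvM d L mv kk hL) L kk r (kingPr L kk r (cvM d L mv kk hL) x') + t • unitVec (fine (L ^ r * L ^ kk) (cvM d L mv kk hL)) μ) * (u' k (kingSec (cvM d L mv kk hL) L kk r (kingPr L kk r (cvM d L mv kk hL) x') + t • unitVec (fine (L ^ r * L ^ kk) (cvM d L mv kk hL)) μ + unitVec (fine (L ^ r * L ^ kk) (cvM d L mv kk hL)) μ))ᴴ)‖ ≤ Ω ∧ ‖u' k ((scShift' d L mv kk r hL μ).symm x') * U' μ ((scShift' d L mv kk r hL μ).symm x') * (u' k (scShift' d L mv kk r hL μ ((scShift' d L mv kk r hL μ).symm x')))ᴴ - (u' k (kingSec (cvM d L mv kk hL) L kk r ((scShift d L mv kk hL μ).symm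 (kingPr L kk r (cvM d L mv kk hL) x')) + t • unitVec (fine (L ^ r * L ^ kk) (cvM d L mv kk hL)) μ) * U' μ (kingSec (cvM d L mv kk hL) L kk r ((scShift d L mv kk hL μ).symm (kingPr L kk r (cvM d L mv kk hL) x')) + t • unitVec (fine (L ^ r * L ^ kk) (cvM d L mv kk hL)) μ) * (u' k (kingSec (cvM d L mv kk hL) L kk r ((scShift d L mv kk hL μ).symm (kingPr L kk r (cvM d L mv kk hL) x')) + t • unitVec (fine (L ^ r * L ^ kk) (cvM d L mv kk hL)) μ + unitVec (fine (L ^ r * L ^ kk) (cvM d L mv kk hL)) μ))ᴴ)‖ ≤ Ω)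
    (hB : ∀ k μ x', scChi d L mv kk hL k (kingPr L kk r (cvM d L mv kk hL) x') ≠ 0 → ∀ i j, |(((((((L ^ r * L ^ kk : ℕ) : ℝ))⁻¹))⁻¹ * (((((L ^ r * L ^ kk : ℕ) : ℝ))⁻¹))⁻¹) • (coordMat e (ContinuousLinearMap.mulLeftRight ℝ (Matrix mm mm ℂ) (u' k x' * U' μ x' * (u' k (scShift' d L mv kk r hL μ x'))ᴴ) (u' k x' * U' μ x' * (u' k (scShift' d L mv kk r hL μ x'))ᴴ)ᴴ) - coordMat e (ContinuousLinearMap.mulLeftRight ℝ (Matrix mm mm ℂ) (u' k ((scShift' d L mv kk r hL μ).symm x') * U' μ ((scShift' d L mv kk r hL μ).symm x') * (u' k (scShift' d L mv kk r hL μ ((scShift' d L mv kk r hL μ).symm x')))ᴴ) (u' k ((scShift' d L mv kk r hL μ).symm x') * U' μ ((scShift' d L mv kk r hL μ).symm x') * (u' k (scShift' d L mv kk r hL μ ((scShift' d L mv kk r hL μ).symm x')))ᴴ)ᴴ)) -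
      ((((((L ^ kk : ℕ) : ℝ))⁻¹))⁻¹ * (((((L ^ kk : ℕ) : ℝ))⁻¹))⁻¹) • (coordMat e (ContinuousLinearMap.mulLeftRight ℝ (Matrix mm mm ℂ) (u' k (kingSec (cvM d L mv kk hL) L kk r (kingPr L kk r (cvM d L mv kk hL) x')) * U μ (kingPr L kk r (cvM d L mv kk hL) x') * (u' k (kingSec (cvM d L mv kk hL) L kk r (scShift d L mv kk hL μ (kingPr L kk r (cvM d L mv kk hL) x'))))ᴴ) (u' k (kingSec (cvM d L mv kk hL) L kk r (kingPr L kk r (cvM d L mv kk hL) x')) * U μ (kingPr L kk r (cvM d L mv kk hL) x') * (u' k (kingSec (cvM d L mv kk hL) L kk r (scShift d L mv kk hL μ (kingPr L kk r (cvM d L mv kk hL) x'))))ᴴ)ᴴ) - coordMat e (ContinuousLinearMap.mulLeftRight ℝ (Matrix mm mm ℂ) (u' k (kingSec (cvM d L mv kk hL) L kk r ((scShift d L mv kk hL μ).symm (kingPr L kk r (cvM d L mv kk hL) x'))) * U μ ((scShift d L mv kk hL μ).symm (kingPr L kk r (cvM d L mv kk hL) x')) * (u' k (kingSec (cvM d L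 mv kk hL) L kk r (scShift d L mv kk hL μ ((scShift d L mv kk hL μ).symm (kingPr L kk r (cvM d L mv kk hL) x')))))ᴴ) (u' k (kingSec (cvM d L mv kk hL) L kk r ((scShift d L mv kk hL μ).symm (kingPr L kk r (cvM d L mv kk hL) x'))) * U μ ((scShift d L mv kk hL μ).symm (kingPr L kk r (cvM d L mv kk hL) x')) * (u' k (kingSec (cvM d L mv kk hL) L kk r (scShift d L mv kk hL μ ((scShift d L mv kk hL μ).symm (kingPr L kk r (cvM d L mv kk hL) x')))))ᴴ)ᴴ))) i j| ≤ oB) :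
    ∀ k x' i, ∑ j, |(scChi' d L mv kk r hL k x' • tCoefC ((((L ^ r * L ^ kk : ℕ) : ℝ))⁻¹) (gaugePair (scShift' d L mv kk r hL) fun μ x' => coordMat e (ContinuousLinearMap.mulLeftRight ℝ (Matrix mm mm ℂ) (u' k x' * U' μ x' * (u' k (scShift' d L mv kk r hL μ x'))ᴴ) (u' k x' * U' μ x' * (u' k (scShift' d L mv kk r hL μ x'))ᴴ)ᴴ)) x') i j - (scChi d L mv kk hL k ((kingPr L kk r (cvM d L mv kk hL)) x') • tCoefC ((((L ^ kk : ℕ) : ℝ))⁻¹) (gaugePair (scShift d L mv kk hL) fun μ x => coordMat e (ContinuousLinearMap.mulLeftRight ℝ (Matrix mm mm ℂ) (u' k (kingSec (cvM d L mv kk hL) L kk r x) * U μ x * (u' k (kingSec (cvM d L mv kk hL) L kk r (scShift d L mv kk hL μ x)))ᴴ) (u' k (kingSec (cvM d L mv kk hL) L kk r x) * U μ x * (u' k (kingSec (cvM d L mv kk hL) L kk r (scShift d L mv kk hL μ x)))ᴴ)ᴴ)) ((kingPr L kk r (cvM d L mv kk hL)) x')) i j| ≤ Fintype.card ι * (Fintype.card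 (Fin (d + 1)) * (oB + Fintype.card ι * ((((L ^ r * L ^ kk : ℕ) : ℝ) * (@basisConst ι _ (Matrix mm mm ℂ) Matrix.frobeniusNormedAddCommGroup Matrix.frobeniusNormedSpace e * (2 * Real.sqrt (Fintype.card mm)) * (Real.sqrt (Fintype.card mm) * Ω) + ((1 + Fintype.card ι * (((((L ^ r * L ^ kk : ℕ) : ℝ))⁻¹) * (@basisConst ι _ (Matrix mm mm ℂ) Matrix.frobeniusNormedAddCommGroup Matrix.frobeniusNormedSpace e * (2 * Real.sqrt (Fintype.card mm)) * (Real.sqrt (Fintype.card mm) * p)))) ^ (L ^ r) - 1) * (((((L ^ r * L ^ kk : ℕ) : ℝ))⁻¹) * (@basisConst ι _ (Matrix mm mm ℂ) Matrix.frobeniusNormedAddCommGroup Matrix.frobeniusNormedSpace e * (2 * Real.sqrt (Fintype.card mm)) * (Real.sqrt (Fintype.card mm) * p))))) * ((@basisConst ι _ (Matrix mm mm ℂ) Matrix.frobeniusNormedAddCommGroup Matrix.frobeniusNormedSpace e * (2 * Real.sqrt (Fintype.card mm)) * (Real.sqrt (Fintype.card mm) * p)) + (((L ^ kk : ℕ)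 : ℝ) * (@basisConst ι _ (Matrix mm mm ℂ) Matrix.frobeniusNormedAddCommGroup Matrix.frobeniusNormedSpace e * (2 * Real.sqrt (Fintype.card mm)) * (Real.sqrt (Fintype.card mm) * ((1 + ((((L ^ r * L ^ kk : ℕ) : ℝ))⁻¹) * p) ^ (L ^ r) - 1)))))))) := by
  have hLpos : 0 < L := Nat.pos_of_ne_zero (NeZero.ne L)
  have hnr : (0 : ℝ) < ((L ^ kk : ℕ) : ℝ) := by exact_mod_cast pow_pos hLpos kk
  have hnr' : (0 : ℝ) < ((L ^ r * L ^ kk : ℕ) : ℝ) := by exact_mod_cast Nat.mul_pos (pow_pos hLpos r) (pow_pos hLpos kk)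
  set κ : ℝ := @basisConst ι _ (Matrix mm mm ℂ) Matrix.frobeniusNormedAddCommGroup Matrix.frobeniusNormedSpace e * (2 * Real.sqrt (Fintype.card mm)) with hκ
  have hκ0 : 0 ≤ κ := mul_nonneg (@basisConst_nonneg ι _ (Matrix mm mm ℂ) Matrix.frobeniusNormedAddCommGroup Matrix.frobeniusNormedSpace e) (by positivity)
  have hη' : (0 : ℝ) ≤ ((((L ^ r * L ^ kk : ℕ) : ℝ))⁻¹) := by positivity
  have hκp : 0 ≤ ((((L ^ r * L ^ kk : ℕ) : ℝ))⁻¹) * p := mul_nonneg hη' hp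
  have hP10 : 0 ≤ ((((L ^ r * L ^ kk : ℕ) : ℝ))⁻¹) * (@basisConst ι _ (Matrix mm mm ℂ) Matrix.frobeniusNormedAddCommGroup Matrix.frobeniusNormedSpace e * (2 * Real.sqrt (Fintype.card mm)) * (Real.sqrt (Fintype.card mm) * p)) := mul_nonneg hη' (mul_nonneg hκ0 (mul_nonneg (Real.sqrt_nonneg _) hp))
  have hB0 : 0 ≤ (((L ^ r * L ^ kk : ℕ) : ℝ) * (@basisConst ι _ (Matrix mm mm ℂ) Matrix.frobeniusNormedAddCommGroup Matrix.frobeniusNormedSpace e * (2 * Real.sqrt (Fintype.card mm)) * (Real.sqrt (Fintype.card mm) * Ω) + ((1 + Fintype.card ι * (((((L ^ r * L ^ kk : ℕ) : ℝ))⁻¹) * (@basisConst ι _ (Matrix mm mm ℂ) Matrix.frobeniusNormedAddCommGroup Matrix.frobeniusNormedSpace e * (2 * Real.sqrt (Fintype.card mm)) * (Real.sqrt (Fintype.card mm) * p)))) ^ (L ^ r) - 1) * (((((L ^ r * L ^ kk : ℕ) : ℝ))⁻¹) * (@basisConst ι _ (Matrix mm mm ℂ) Matrix.frobeniusNormedAddCommGroup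 Matrix.frobeniusNormedSpace e * (2 * Real.sqrt (Fintype.card mm)) * (Real.sqrt (Fintype.card mm) * p))))) := by
    have h1 : (1 : ℝ) ≤ (1 + Fintype.card ι * (((((L ^ r * L ^ kk : ℕ) : ℝ))⁻¹) * (@basisConst ι _ (Matrix mm mm ℂ) Matrix.frobeniusNormedAddCommGroup Matrix.frobeniusNormedSpace e * (2 * Real.sqrt (Fintype.card mm)) * (Real.sqrt (Fintype.card mm) * p)))) ^ (L ^ r) := one_le_pow₀ (le_add_of_nonneg_right (mul_nonneg (Nat.cast_nonneg _) hP10))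
    exact mul_nonneg (Nat.cast_nonneg _) (add_nonneg (mul_nonneg hκ0 (mul_nonneg (Real.sqrt_nonneg _) hΩ0)) (mul_nonneg (by linarith) hP10))
  have hσ0 : 0 ≤ (1 + ((((L ^ r * L ^ kk : ℕ) : ℝ))⁻¹) * p) ^ (L ^ r) - 1 := by have := one_le_pow₀ (M₀ := ℝ) (a := 1 + ((((L ^ r * L ^ kk : ℕ) : ℝ))⁻¹) * p) (by linarith) (n := L ^ r); linarith
  have hPC0 : 0 ≤ (((L ^ kk : ℕ) : ℝ) * (@basisConst ι _ (Matrix mm mm ℂ) Matrix.frobeniusNormedAddCommGroup Matrix.frobeniusNormedSpace e * (2 * Real.sqrt (Fintype.card mm)) * (Real.sqrt (Fintype.card mm) * ((1 + ((((L ^ r * L ^ kk : ℕ) : ℝ))⁻¹) * p) ^ (L ^ r) - 1)))) := by positivity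
  have hOV0 : 0 ≤ oB + Fintype.card ι * ((((L ^ r * L ^ kk : ℕ) : ℝ) * (@basisConst ι _ (Matrix mm mm ℂ) Matrix.frobeniusNormedAddCommGroup Matrix.frobeniusNormedSpace e * (2 * Real.sqrt (Fintype.card mm)) * (Real.sqrt (Fintype.card mm) * Ω) + ((1 + Fintype.card ι * (((((L ^ r * L ^ kk : ℕ) : ℝ))⁻¹) * (@basisConst ι _ (Matrix mm mm ℂ) Matrix.frobeniusNormedAddCommGroup Matrix.frobeniusNormedSpace e * (2 * Real.sqrt (Fintype.card mm)) * (Real.sqrt (Fintype.card mm) * p)))) ^ (L ^ r) - 1) * (((((L ^ r * L ^ kk : ℕ) : ℝ))⁻¹) * (@basisConst ι _ (Matrix mm mm ℂ) Matrix.frobeniusNormedAddCommGroup Matrix.frobeniusNormedSpace e * (2 * Real.sqrt (Fintype.card mm)) * (Real.sqrt (Fintype.card mm) * p))))) * ((@basisConst ι _ (Matrix mm mm ℂ) Matrix.frobeniusNormedAddCommGroup Matrix.frobeniusNormedSpace e * (2 * Real.sqrt (Fintype.card mm)) * (Real.sqrt (Fintype.card mm) * p)) + (((L ^ kk : ℕ)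 : ℝ) * (@basisConst ι _ (Matrix mm mm ℂ) Matrix.frobeniusNormedAddCommGroup Matrix.frobeniusNormedSpace e * (2 * Real.sqrt (Fintype.card mm)) * (Real.sqrt (Fintype.card mm) * ((1 + ((((L ^ r * L ^ kk : ℕ) : ℝ))⁻¹) * p) ^ (L ^ r) - 1)))))) := by positivity
  intro k x' i
  rw [scChi'_eq_scChi_kingPr]
  by_cases hχ : scChi d L mv kk hL k (kingPr L kk r (cvM d L mv kk hL) x') = 0
  · simp only [hχ, zero_smul, Matrix.zero_apply, sub_self, abs_zero, Finset.sum_const_zero]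
    positivity
  have hc1 : |scChi d L mv kk hL k (kingPr L kk r (cvM d L mv kk hL) x')| ≤ 1 := abs_chiCube_le_one _ _
  -- the entrywise fit, direction by direction
  have hdir : ∀ (μ : Fin (d + 1)) (j : ι), |((((((L ^ r * L ^ kk : ℕ) : ℝ))⁻¹))⁻¹ • (tCoefA ((((L ^ r * L ^ kk : ℕ) : ℝ))⁻¹) (gaugePair (scShift' d L mv kk r hL) (fun μ x' => coordMat e (ContinuousLinearMap.mulLeftRight ℝ (Matrix mm mm ℂ) (u' k x' * U' μ x' * (u' k (scShift' d L mv kk r hL μ x'))ᴴ) (u' k x' * U' μ x' * (u' k (scShift' d L mv kk r hL μ x'))ᴴ)ᴴ))) (Sum.inl μ) x' - tCoefA ((((L ^ r * L ^ kk : ℕ) : ℝ))⁻¹) (gaugePair (scShift' d L mv kk r hL) (fun μ x' => coordMat e (ContinuousLinearMap.mulLeftRight ℝ (Matrix mm mm ℂ) (u' k x' * U' μ x' * (u' k (scShift' d L mv kk r hL μ x'))ᴴ) (u' k x' * U' μ x' * (u' k (scShift' d L mv kk r hL μ x'))ᴴ)ᴴ))) (Sum.inr μ) x') -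
      (((((L ^ kk : ℕ) : ℝ))⁻¹))⁻¹ • (tCoefA ((((L ^ kk : ℕ) : ℝ))⁻¹) (gaugePair (scShift d L mv kk hL) (fun μ x => coordMat e (ContinuousLinearMap.mulLeftRight ℝ (Matrix mm mm ℂ) (u' k (kingSec (cvM d L mv kk hL) L kk r x) * U μ x * (u' k (kingSec (cvM d L mv kk hL) L kk r (scShift d L mv kk hL μ x)))ᴴ) (u' k (kingSec (cvM d L mv kk hL) L kk r x) * U μ x * (u' k (kingSec (cvM d L mv kk hL) L kk r (scShift d L mv kk hL μ x)))ᴴ)ᴴ))) (Sum.inl μ) (kingPr L kk r (cvM d L mv kk hL) x') - tCoefA ((((L ^ kk : ℕ) : ℝ))⁻¹) (gaugePair (scShift d L mv kk hL) (fun μ x => coordMat e (ContinuousLinearMap.mulLeftRight ℝ (Matrix mm mm ℂ) (u' k (kingSec (cvM d L mv kk hL) L kk r x) * U μ x * (u' k (kingSec (cvM d L mv kk hL) L kk r (scShift d L mv kk hL μ x)))ᴴ) (u' k (kingSec (cvM d L mv kk hL) L kk r x) * U μ x * (u' k (kingSec (cvM d L mv kk hL) L kk r (scShift d L mv kk hL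 μ x)))ᴴ)ᴴ))) (Sum.inr μ) (kingPr L kk r (cvM d L mv kk hL) x'))) i j| ≤ (oB + Fintype.card ι * ((((L ^ r * L ^ kk : ℕ) : ℝ) * (@basisConst ι _ (Matrix mm mm ℂ) Matrix.frobeniusNormedAddCommGroup Matrix.frobeniusNormedSpace e * (2 * Real.sqrt (Fintype.card mm)) * (Real.sqrt (Fintype.card mm) * Ω) + ((1 + Fintype.card ι * (((((L ^ r * L ^ kk : ℕ) : ℝ))⁻¹) * (@basisConst ι _ (Matrix mm mm ℂ) Matrix.frobeniusNormedAddCommGroup Matrix.frobeniusNormedSpace e * (2 * Real.sqrt (Fintype.card mm)) * (Real.sqrt (Fintype.card mm) * p)))) ^ (L ^ r) - 1) * (((((L ^ r * L ^ kk : ℕ) : ℝ))⁻¹) * (@basisConst ι _ (Matrix mm mm ℂ) Matrix.frobeniusNormedAddCommGroup Matrix.frobeniusNormedSpace e * (2 * Real.sqrt (Fintype.card mm)) * (Real.sqrt (Fintype.card mm) * p))))) * ((@basisConst ι _ (Matrix mm mm ℂ) Matrix.frobeniusNormedAddCommGroup Matrix.frobeniusNormedSpace e * (2 * Real.sqrt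 (Fintype.card mm)) * (Real.sqrt (Fintype.card mm) * p)) + (((L ^ kk : ℕ) : ℝ) * (@basisConst ι _ (Matrix mm mm ℂ) Matrix.frobeniusNormedAddCommGroup Matrix.frobeniusNormedSpace e * (2 * Real.sqrt (Fintype.card mm)) * (Real.sqrt (Fintype.card mm) * ((1 + ((((L ^ r * L ^ kk : ℕ) : ℝ))⁻¹) * p) ^ (L ^ r) - 1))))))) := by
    intro μ j
    obtain ⟨hw, hlines⟩ := hQl k x' hχ μ
    -- unitarity ∕ orthogonality at the two backward points
    have hVw : (u' k ((scShift' d L mv kk r hL μ).symm x') * U' μ ((scShift' d L mv kk r hL μ).symm x') * (u' k (scShift' d L mv kk r hL μ ((scShift' d L mv kk r hL μ).symm x')))ᴴ)ᴴ * (u' k ((scShift' d L mv kk r hL μ).symm x') * U' μ ((scShift' d L mv kk r hL μ).symm x') * (u' k (scShift' d L mv kk r hL μ ((scShift' d L mv kk r hL μ).symm x')))ᴴ) = 1 := uN_gaugeTransformed_bond_unitary (scShift' d L mv kk r hL) (u' k) U' (hu' k) hU' μ _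
    have hVv : (u' k (kingSec (cvM d L mv kk hL) L kk r ((scShift d L mv kk hL μ).symm (kingPr L kk r (cvM d L mv kk hL) x'))) * U μ ((scShift d L mv kk hL μ).symm (kingPr L kk r (cvM d L mv kk hL) x')) * (u' k (kingSec (cvM d L mv kk hL) L kk r (scShift d L mv kk hL μ ((scShift d L mv kk hL μ).symm (kingPr L kk r (cvM d L mv kk hL) x')))))ᴴ)ᴴ * (u' k (kingSec (cvM d L mv kk hL) L kk r ((scShift d L mv kk hL μ).symm (kingPr L kk r (cvM d L mv kk hL) x'))) * U μ ((scShift d L mv kk hL μ).symm (kingPr L kk r (cvM d L mv kk hL) x')) * (u' k (kingSec (cvM d L mv kk hL) L kk r (scShift d L mv kk hL μ ((scShift d L mv kk hL μ).symm (kingPr L kk r (cvM d L mv kk hL) x')))))ᴴ) = 1 := uN_gaugeTransformed_bond_unitary (scShift d L mv kk hL) (fun x => u' k (kingSec (cvM d L mv kk hL) L kk r x)) U (fun x => hu' k _) hU μ _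
    have hSm' := (uN_coordMat_conj_orthogonal e he hVw).2
    have hSm := (uN_coordMat_conj_orthogonal e he hVv).2
    -- the first-order fit `δ` at the backward pair (n15-c∕343) and the two bounds of `ã′`, `ã`
    have hd := abs_tCoefA_fit_entry_le e (hu' k) hU' μ (hpair μ) hp ((scShift d L mv kk hL μ).symm (kingPr L kk r (cvM d L mv kk hL) x')) ((scShift' d L mv kk r hL μ).symm x') (fun t ht => hF1 k μ _ (hlines t ht).2) (fun t ht => (hΩ k μ x' hχ t ht).2)
    have hA' : ∀ a b, |((((((L ^ r * L ^ kk : ℕ) : ℝ))⁻¹))⁻¹ • (coordMat e (ContinuousLinearMap.mulLeftRight ℝ (Matrix mm mm ℂ) (u' k ((scShift' d L mv kk r hL μ).symm x') * U' μ ((scShift' d L mv kk r hL μ).symm x') * (u' k (scShift' d L mv kk r hL μ ((scShift' d L mv kk r hL μ).symm x')))ᴴ) (u' k ((scShift' d L mv kk r hL μ).symm x') * U' μ ((scShift' d L mv kk r hL μ).symm x') * (u' k (scShift' d L mv kk r hL μ ((scShift' d L mv kk r hL μ).symm x')))ᴴ)ᴴ) - 1)) a b| ≤ (@basisConst ι _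 (Matrix mm mm ℂ) Matrix.frobeniusNormedAddCommGroup Matrix.frobeniusNormedSpace e * (2 * Real.sqrt (Fintype.card mm)) * (Real.sqrt (Fintype.card mm) * p)) := fun a b => by
      rw [Matrix.smul_apply, smul_eq_mul, abs_mul, abs_of_nonneg (by rw [inv_inv]; exact hnr'.le), inv_inv]
      refine (mul_le_mul_of_nonneg_left ((uN_abs_coordMat_conj_sub_one_entry_le_op e hVw a b).trans (mul_le_mul_of_nonneg_left (mul_le_mul_of_nonneg_left (hF1 k μ _ hw) (Real.sqrt_nonneg _)) hκ0)) hnr'.le).trans (le_of_eq ?_)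
      field_simp
    have hA : ∀ a b, |((((((L ^ kk : ℕ) : ℝ))⁻¹))⁻¹ • (coordMat e (ContinuousLinearMap.mulLeftRight ℝ (Matrix mm mm ℂ) (u' k (kingSec (cvM d L mv kk hL) L kk r ((scShift d L mv kk hL μ).symm (kingPr L kk r (cvM d L mv kk hL) x'))) * U μ ((scShift d L mv kk hL μ).symm (kingPr L kk r (cvM d L mv kk hL) x')) * (u' k (kingSec (cvM d L mv kk hL) L kk r (scShift d L mv kk hL μ ((scShift d L mv kk hL μ).symm (kingPr L kk r (cvM d L mv kk hL) x')))))ᴴ) (u' k (kingSec (cvM d L mv kk hL) L kk r ((scShift d L mv kk hL μ).symm (kingPr L kk r (cvM d L mv kk hL) x'))) * U μ ((scShift d L mv kk hL μ).symm (kingPr L kk r (cvM d L mv kk hL) x')) * (u' k (kingSec (cvM d L mv kk hL) L kk r (scShift d L mv kk hL μ ((scShift d L mv kk hL μ).symm (kingPr L kk r (cvM d L mv kk hL) x')))))ᴴ)ᴴ) - 1)) a b| ≤ (((L ^ kk : ℕ) : ℝ) * (@basisConst ι _ (Matrix mm mm ℂ) Matrix.frobeniusNormedAddCommGroup Matrix.frobeniusNormedSpace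 e * (2 * Real.sqrt (Fintype.card mm)) * (Real.sqrt (Fintype.card mm) * ((1 + ((((L ^ r * L ^ kk : ℕ) : ℝ))⁻¹) * p) ^ (L ^ r) - 1)))) := fun a b => by
      rw [Matrix.smul_apply, smul_eq_mul, abs_mul, abs_of_nonneg (by rw [inv_inv]; exact hnr.le), inv_inv]
      refine mul_le_mul_of_nonneg_left ((uN_abs_coordMat_conj_sub_one_entry_le_op e hVv a b).trans (mul_le_mul_of_nonneg_left (mul_le_mul_of_nonneg_left ?_ (Real.sqrt_nonneg _)) hκ0)) hnr.le
      have h1 := norm_gauged_lineHol_sub_one_le (cvM d L mv kk hL) L kk r (hu' k) U' hκp μ ((scShift d L mv kk hL μ).symm (kingPr L kk r (cvM d L mv kk hL) x')) (fun t ht => hF1 k μ _ (hlines t ht).2)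
      rw [← hpair μ] at h1
      exact h1
    simp only [tCoefA_inl, tCoefA_inr, gaugePair_inl, gaugePair_inr]
    exact abs_tCoefC_dir_fit_entry_le hSm hSm' (hB k μ x' hχ) hd hA' hA i j
  -- the zeroth-order coefficient is `η⁻¹Σ_μ(a⁺ − a⁻)`
  have hentry : ∀ j, |tCoefC ((((L ^ r * L ^ kk : ℕ) : ℝ))⁻¹) (gaugePair (scShift' d L mv kk r hL) (fun μ x' => coordMat e (ContinuousLinearMap.mulLeftRight ℝ (Matrix mm mm ℂ) (u' k x' * U' μ x' * (u' k (scShift' d L mv kk r hL μ x'))ᴴ) (u' k x' * U' μ x' * (u' k (scShift' d L mv kk r hL μ x'))ᴴ)ᴴ))) x' i j - tCoefC ((((L ^ kk : ℕ) : ℝ))⁻¹) (gaugePair (scShift d L mv kk hL) (fun μ x => coordMat e (ContinuousLinearMap.mulLeftRight ℝ (Matrix mm mm ℂ) (u' k (kingSec (cvM d L mv kk hL) L kk r x) * U μ x * (u' k (kingSec (cvM d L mv kk hL) L kk r (scShift d L mv kk hL μ x)))ᴴ) (u' k (kingSec (cvM d L mv kk hL) L kk r x) * U μ x * (u' k (kingSec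 (cvM d L mv kk hL) L kk r (scShift d L mv kk hL μ x)))ᴴ)ᴴ))) (kingPr L kk r (cvM d L mv kk hL) x') i j| ≤ Fintype.card (Fin (d + 1)) * (oB + Fintype.card ι * ((((L ^ r * L ^ kk : ℕ) : ℝ) * (@basisConst ι _ (Matrix mm mm ℂ) Matrix.frobeniusNormedAddCommGroup Matrix.frobeniusNormedSpace e * (2 * Real.sqrt (Fintype.card mm)) * (Real.sqrt (Fintype.card mm) * Ω) + ((1 + Fintype.card ι * (((((L ^ r * L ^ kk : ℕ) : ℝ))⁻¹) * (@basisConst ι _ (Matrix mm mm ℂ) Matrix.frobeniusNormedAddCommGroup Matrix.frobeniusNormedSpace e * (2 * Real.sqrt (Fintype.card mm)) * (Real.sqrt (Fintype.card mm) * p)))) ^ (L ^ r) - 1) * (((((L ^ r * L ^ kk : ℕ) : ℝ))⁻¹) * (@basisConst ι _ (Matrix mm mm ℂ) Matrix.frobeniusNormedAddCommGroup Matrix.frobeniusNormedSpace e * (2 * Real.sqrt (Fintype.card mm)) * (Real.sqrt (Fintype.card mm) * p))))) * ((@basisConst ι _ (Matrix mm mm ℂ) Matrix.frobeniusNormedAddCommGroup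 Matrix.frobeniusNormedSpace e * (2 * Real.sqrt (Fintype.card mm)) * (Real.sqrt (Fintype.card mm) * p)) + (((L ^ kk : ℕ) : ℝ) * (@basisConst ι _ (Matrix mm mm ℂ) Matrix.frobeniusNormedAddCommGroup Matrix.frobeniusNormedSpace e * (2 * Real.sqrt (Fintype.card mm)) * (Real.sqrt (Fintype.card mm) * ((1 + ((((L ^ r * L ^ kk : ℕ) : ℝ))⁻¹) * p) ^ (L ^ r) - 1))))))) := fun j => by
    have e1 : tCoefC ((((L ^ r * L ^ kk : ℕ) : ℝ))⁻¹) (gaugePair (scShift' d L mv kk r hL) (fun μ x' => coordMat e (ContinuousLinearMap.mulLeftRight ℝ (Matrix mm mm ℂ) (u' k x' * U' μ x' * (u' k (scShift' d L mv kk r hL μ x'))ᴴ) (u' k x' * U' μ x' * (u' k (scShift' d L mv kk r hL μ x'))ᴴ)ᴴ))) x' i j - tCoefC ((((L ^ kk : ℕ) : ℝ))⁻¹) (gaugePair (scShift d L mv kk hL) (fun μ x => coordMat e (ContinuousLinearMap.mulLeftRight ℝ (Matrix mm mm ℂ) (u' k (kingSec (cvM d L mv kk hL) L kk r x) * U μ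 x * (u' k (kingSec (cvM d L mv kk hL) L kk r (scShift d L mv kk hL μ x)))ᴴ) (u' k (kingSec (cvM d L mv kk hL) L kk r x) * U μ x * (u' k (kingSec (cvM d L mv kk hL) L kk r (scShift d L mv kk hL μ x)))ᴴ)ᴴ))) (kingPr L kk r (cvM d L mv kk hL) x') i j =
        (∑ μ, ((((((L ^ r * L ^ kk : ℕ) : ℝ))⁻¹))⁻¹ • (tCoefA ((((L ^ r * L ^ kk : ℕ) : ℝ))⁻¹) (gaugePair (scShift' d L mv kk r hL) (fun μ x' => coordMat e (ContinuousLinearMap.mulLeftRight ℝ (Matrix mm mm ℂ) (u' k x' * U' μ x' * (u' k (scShift' d L mv kk r hL μ x'))ᴴ) (u' k x' * U' μ x' * (u' k (scShift' d L mv kk r hL μ x'))ᴴ)ᴴ))) (Sum.inl μ) x' - tCoefA ((((L ^ r * L ^ kk : ℕ) : ℝ))⁻¹) (gaugePair (scShift' d L mv kk r hL) (fun μ x' => coordMat e (ContinuousLinearMap.mulLeftRight ℝ (Matrix mm mm ℂ) (u' k x' * U' μ x' * (u' k (scShift' d L mv kk r hL μ x'))ᴴ) (u' k x' * U' μ x'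 * (u' k (scShift' d L mv kk r hL μ x'))ᴴ)ᴴ))) (Sum.inr μ) x') -
          (((((L ^ kk : ℕ) : ℝ))⁻¹))⁻¹ • (tCoefA ((((L ^ kk : ℕ) : ℝ))⁻¹) (gaugePair (scShift d L mv kk hL) (fun μ x => coordMat e (ContinuousLinearMap.mulLeftRight ℝ (Matrix mm mm ℂ) (u' k (kingSec (cvM d L mv kk hL) L kk r x) * U μ x * (u' k (kingSec (cvM d L mv kk hL) L kk r (scShift d L mv kk hL μ x)))ᴴ) (u' k (kingSec (cvM d L mv kk hL) L kk r x) * U μ x * (u' k (kingSec (cvM d L mv kk hL) L kk r (scShift d L mv kk hL μ x)))ᴴ)ᴴ))) (Sum.inl μ) (kingPr L kk r (cvM d L mv kk hL) x') - tCoefA ((((L ^ kk : ℕ) : ℝ))⁻¹) (gaugePair (scShift d L mv kk hL) (fun μ x => coordMat e (ContinuousLinearMap.mulLeftRight ℝ (Matrix mm mm ℂ) (u' k (kingSec (cvM d L mv kk hL) L kk r x) * U μ x * (u' k (kingSec (cvM d L mv kk hL) L kk r (scShift d L mv kk hL μ x)))ᴴ) (u' k (kingSec (cvM d L mv kk hL)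 L kk r x) * U μ x * (u' k (kingSec (cvM d L mv kk hL) L kk r (scShift d L mv kk hL μ x)))ᴴ)ᴴ))) (Sum.inr μ) (kingPr L kk r (cvM d L mv kk hL) x')))) i j := by
      rw [show ∀ (η₀ : ℝ) (R : Fin (d + 1) ⊕ Fin (d + 1) → _ → Matrix ι ι ℝ) (x), tCoefC η₀ R x = η₀⁻¹ • ∑ μ, (tCoefA η₀ R (Sum.inl μ) x - tCoefA η₀ R (Sum.inr μ) x) from fun _ _ _ => rfl,
        show ∀ (η₀ : ℝ) (R : Fin (d + 1) ⊕ Fin (d + 1) → _ → Matrix ι ι ℝ) (x), tCoefC η₀ R x = η₀⁻¹ • ∑ μ, (tCoefA η₀ R (Sum.inl μ) x - tCoefA η₀ R (Sum.inr μ) x) from fun _ _ _ => rfl,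
        Finset.smul_sum, Finset.smul_sum, ← Matrix.sub_apply, ← Finset.sum_sub_distrib]
    rw [e1, Matrix.sum_apply]
    refine (Finset.abs_sum_le_sum_abs _ _).trans ?_
    calc ∑ μ, |_| ≤ ∑ _μ : Fin (d + 1), (oB + Fintype.card ι * ((((L ^ r * L ^ kk : ℕ) : ℝ) * (@basisConst ι _ (Matrix mm mm ℂ) Matrix.frobeniusNormedAddCommGroup Matrix.frobeniusNormedSpace e * (2 * Real.sqrt (Fintype.card mm)) * (Real.sqrt (Fintype.card mm) * Ω) + ((1 + Fintype.card ι * (((((L ^ r * L ^ kk : ℕ) : ℝ))⁻¹) * (@basisConst ι _ (Matrix mm mm ℂ) Matrix.frobeniusNormedAddCommGroup Matrix.frobeniusNormedSpace e * (2 * Real.sqrt (Fintype.card mm)) * (Real.sqrt (Fintype.card mm) * p)))) ^ (L ^ r) - 1) * (((((L ^ r * L ^ kk : ℕ) : ℝ))⁻¹) * (@basisConst ι _ (Matrix mm mm ℂ) Matrix.frobeniusNormedAddCommGroup Matrix.frobeniusNormedSpace e * (2 * Real.sqrt (Fintype.card mm)) * (Real.sqrt (Fintype.card mm) * p))))) *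 ((@basisConst ι _ (Matrix mm mm ℂ) Matrix.frobeniusNormedAddCommGroup Matrix.frobeniusNormedSpace e * (2 * Real.sqrt (Fintype.card mm)) * (Real.sqrt (Fintype.card mm) * p)) + (((L ^ kk : ℕ) : ℝ) * (@basisConst ι _ (Matrix mm mm ℂ) Matrix.frobeniusNormedAddCommGroup Matrix.frobeniusNormedSpace e * (2 * Real.sqrt (Fintype.card mm)) * (Real.sqrt (Fintype.card mm) * ((1 + ((((L ^ r * L ^ kk : ℕ) : ℝ))⁻¹) * p) ^ (L ^ r) - 1))))))) := Finset.sum_le_sum fun μ _ => hdir μ j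
      _ = Fintype.card (Fin (d + 1)) * (oB + Fintype.card ι * ((((L ^ r * L ^ kk : ℕ) : ℝ) * (@basisConst ι _ (Matrix mm mm ℂ) Matrix.frobeniusNormedAddCommGroup Matrix.frobeniusNormedSpace e * (2 * Real.sqrt (Fintype.card mm)) * (Real.sqrt (Fintype.card mm) * Ω) + ((1 + Fintype.card ι * (((((L ^ r * L ^ kk : ℕ) : ℝ))⁻¹) * (@basisConst ι _ (Matrix mm mm ℂ) Matrix.frobeniusNormedAddCommGroup Matrix.frobeniusNormedSpace e * (2 * Real.sqrt (Fintype.card mm)) * (Real.sqrt (Fintype.card mm) * p)))) ^ (L ^ r) - 1) * (((((L ^ r * L ^ kk : ℕ) : ℝ))⁻¹) * (@basisConst ι _ (Matrix mm mm ℂ) Matrix.frobeniusNormedAddCommGroup Matrix.frobeniusNormedSpace e * (2 * Real.sqrt (Fintype.card mm)) * (Real.sqrt (Fintype.card mm) * p))))) * ((@basisConst ι _ (Matrix mm mm ℂ) Matrix.frobeniusNormedAddCommGroup Matrix.frobeniusNormedSpace e * (2 * Real.sqrt (Fintype.card mm)) * (Real.sqrt (Fintype.card mm) * p)) + (((L ^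 kk : ℕ) : ℝ) * (@basisConst ι _ (Matrix mm mm ℂ) Matrix.frobeniusNormedAddCommGroup Matrix.frobeniusNormedSpace e * (2 * Real.sqrt (Fintype.card mm)) * (Real.sqrt (Fintype.card mm) * ((1 + ((((L ^ r * L ^ kk : ℕ) : ℝ))⁻¹) * p) ^ (L ^ r) - 1))))))) := by rw [Finset.sum_const, Finset.card_univ, nsmul_eq_mul]
  calc ∑ j, |(scChi d L mv kk hL k (kingPr L kk r (cvM d L mv kk hL) x') • tCoefC ((((L ^ r * L ^ kk : ℕ) : ℝ))⁻¹) (gaugePair (scShift' d L mv kk r hL) (fun μ x' => coordMat e (ContinuousLinearMap.mulLeftRight ℝ (Matrix mm mm ℂ) (u' k x' * U' μ x' * (u' k (scShift' d L mv kk r hL μ x'))ᴴ) (u' k x' * U' μ x' * (u' k (scShift' d L mv kk r hL μ x'))ᴴ)ᴴ))) x') i j -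
          (scChi d L mv kk hL k (kingPr L kk r (cvM d L mv kk hL) x') • tCoefC ((((L ^ kk : ℕ) : ℝ))⁻¹) (gaugePair (scShift d L mv kk hL) (fun μ x => coordMat e (ContinuousLinearMap.mulLeftRight ℝ (Matrix mm mm ℂ) (u' k (kingSec (cvM d L mv kk hL) L kk r x) * U μ x * (u' k (kingSec (cvM d L mv kk hL) L kk r (scShift d L mv kk hL μ x)))ᴴ) (u' k (kingSec (cvM d L mv kk hL) L kk r x) * U μ x * (u' k (kingSec (cvM d L mv kk hL) L kk r (scShift d L mv kk hL μ x)))ᴴ)ᴴ))) (kingPr L kk r (cvM d L mv kk hL) x')) i j|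
      = ∑ j, |scChi d L mv kk hL k (kingPr L kk r (cvM d L mv kk hL) x')| * |tCoefC ((((L ^ r * L ^ kk : ℕ) : ℝ))⁻¹) (gaugePair (scShift' d L mv kk r hL) (fun μ x' => coordMat e (ContinuousLinearMap.mulLeftRight ℝ (Matrix mm mm ℂ) (u' k x' * U' μ x' * (u' k (scShift' d L mv kk r hL μ x'))ᴴ) (u' k x' * U' μ x' * (u' k (scShift' d L mv kk r hL μ x'))ᴴ)ᴴ))) x' i j - tCoefC ((((L ^ kk : ℕ) : ℝ))⁻¹) (gaugePair (scShift d L mv kk hL) (fun μ x => coordMat e (ContinuousLinearMap.mulLeftRight ℝ (Matrix mm mm ℂ) (u' k (kingSec (cvM d L mv kk hL) L kk r x) * U μ x * (u' k (kingSec (cvM d L mv kk hL) L kk r (scShift d L mv kk hL μ x)))ᴴ) (u' k (kingSec (cvM d L mv kk hL) L kk r x) * U μ x * (u' k (kingSec (cvM d L mv kk hL) L kk r (scShift d L mv kk hL μ x)))ᴴ)ᴴ))) (kingPr L kk r (cvM d L mv kk hL) x') i j| :=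
        Finset.sum_congr rfl fun j _ => by rw [Matrix.smul_apply, Matrix.smul_apply, smul_eq_mul, smul_eq_mul, ← mul_sub, abs_mul]
    _ ≤ ∑ _j : ι, 1 * (Fintype.card (Fin (d + 1)) * (oB + Fintype.card ι * ((((L ^ r * L ^ kk : ℕ) : ℝ) * (@basisConst ι _ (Matrix mm mm ℂ) Matrix.frobeniusNormedAddCommGroup Matrix.frobeniusNormedSpace e * (2 * Real.sqrt (Fintype.card mm)) * (Real.sqrt (Fintype.card mm) * Ω) + ((1 + Fintype.card ι * (((((L ^ r * L ^ kk : ℕ) : ℝ))⁻¹) * (@basisConst ι _ (Matrix mm mm ℂ) Matrix.frobeniusNormedAddCommGroup Matrix.frobeniusNormedSpace e * (2 * Real.sqrt (Fintype.card mm)) * (Real.sqrt (Fintype.card mm) * p)))) ^ (L ^ r) - 1) * (((((L ^ r * L ^ kk : ℕ) : ℝ))⁻¹) * (@basisConst ι _ (Matrix mm mm ℂ) Matrix.frobeniusNormedAddCommGroup Matrix.frobeniusNormedSpace e * (2 * Real.sqrt (Fintype.card mm)) * (Real.sqrt (Fintype.card mm) * p))))) * ((@basisConst ι _ (Matrix mm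 mm ℂ) Matrix.frobeniusNormedAddCommGroup Matrix.frobeniusNormedSpace e * (2 * Real.sqrt (Fintype.card mm)) * (Real.sqrt (Fintype.card mm) * p)) + (((L ^ kk : ℕ) : ℝ) * (@basisConst ι _ (Matrix mm mm ℂ) Matrix.frobeniusNormedAddCommGroup Matrix.frobeniusNormedSpace e * (2 * Real.sqrt (Fintype.card mm)) * (Real.sqrt (Fintype.card mm) * ((1 + ((((L ^ r * L ^ kk : ℕ) : ℝ))⁻¹) * p) ^ (L ^ r) - 1)))))))) := Finset.sum_le_sum fun j _ => mul_le_mul hc1 (hentry j) (abs_nonneg _) zero_le_one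
    _ = Fintype.card ι * (Fintype.card (Fin (d + 1)) * (oB + Fintype.card ι * ((((L ^ r * L ^ kk : ℕ) : ℝ) * (@basisConst ι _ (Matrix mm mm ℂ) Matrix.frobeniusNormedAddCommGroup Matrix.frobeniusNormedSpace e * (2 * Real.sqrt (Fintype.card mm)) * (Real.sqrt (Fintype.card mm) * Ω) + ((1 + Fintype.card ι * (((((L ^ r * L ^ kk : ℕ) : ℝ))⁻¹) * (@basisConst ι _ (Matrix mm mm ℂ) Matrix.frobeniusNormedAddCommGroup Matrix.frobeniusNormedSpace e * (2 * Real.sqrt (Fintype.card mm)) * (Real.sqrt (Fintype.card mm) * p)))) ^ (L ^ r) - 1) * (((((L ^ r * L ^ kk : ℕ) : ℝ))⁻¹) * (@basisConst ι _ (Matrix mm mm ℂ) Matrix.frobeniusNormedAddCommGroup Matrix.frobeniusNormedSpace e * (2 * Real.sqrt (Fintype.card mm)) * (Real.sqrt (Fintype.card mm) * p))))) * ((@basisConst ι _ (Matrix mm mm ℂ) Matrix.frobeniusNormedAddCommGroup Matrix.frobeniusNormedSpace e * (2 * Real.sqrt (Fintype.card mm)) * (Real.sqrt (Fintype.card mm)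 * p)) + (((L ^ kk : ℕ) : ℝ) * (@basisConst ι _ (Matrix mm mm ℂ) Matrix.frobeniusNormedAddCommGroup Matrix.frobeniusNormedSpace e * (2 * Real.sqrt (Fintype.card mm)) * (Real.sqrt (Fintype.card mm) * ((1 + ((((L ^ r * L ^ kk : ℕ) : ℝ))⁻¹) * p) ^ (L ^ r) - 1)))))))) := by rw [one_mul, Finset.sum_const, Finset.card_univ, nsmul_eq_mul]

end Sites

end Summit.QuantumFields.YangMills.BalabanUVNodes.N15.Gluing

end
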